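import Mathlib.LinearAlgebra.Matrix.Charpoly.Coeff
import Mathlib.LinearAlgebra.Matrix.ToLinearEquiv
import Mathlib.LinearAlgebra.FiniteDimensional.Lemmas
import Mathlib.FieldTheory.IsAlgClosed.Basic
import HarnessLib

/-!
# Route `PhantomRMYoshida`, crux `ResiduallyYoshidaLifting` (stmt-Langlands-13639), line `sector-klingen-split`:
# stub LR2 `stub_crossRatioOfTameEigen` — `S X = q X S'` with `X ≠ 0` forces a cross ratio `α = q β` of eigenvalues

The registered sub-goal `stub_crossRatioOfTameEigen` of the checked skeleton (rev 16, lead c5-0).  Setting: an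
algebraically closed field `k`, matrices `S, S', X ∈ M₂(k)` (think `σ̄(Frob_v)`, `σ̄'(Frob_v)` and the value `B(τ)` of a
ramified Selmer cocycle on a tame inertia element) and a scalar `q` (think `q_v`), with `X ≠ 0` and `S X = q · X S'`.

Claim: `α = q β` for some root `α` of `charpoly S` and some root `β` of `charpoly S'` (the ×-type level-raising, or
CROSS-RATIO, condition of line C).

Proof.  A root of the characteristic polynomial of a square matrix over a field is the same thing as an eigenvalue
with a non-zero eigenvector (`Matrix.eval_charpoly`, `Matrix.exists_mulVec_eq_zero_iff`).  Since `k` is algebraically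
closed, `charpoly S'` (degree `2`) has a root `β`, with an eigenvector `y ≠ 0`, `S' y = β y`.
* If `X y ≠ 0`: `S (X y) = q X S' y = (q β) (X y)`, so `α := q β` is an eigenvalue of `S`.
* If `X y = 0`: pick `y₂` with `X y₂ ≠ 0` (`X ≠ 0`); then `y, y₂` is a basis of `k²` (apply `X` to a dependence), so
  `S' y₂ = γ y + δ y₂` and `X S' y₂ = δ X y₂`, whence `S (X y₂) = q X S' y₂ = (q δ) (X y₂)`: `α := q δ` is an eigenvalue
  of `S`.  Finally `δ` is an eigenvalue of `S'`: either `δ = β`, or `y₂ + (γ / (δ - β)) y` (non-zero, as `X` does not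
  kill it) is an eigenvector of `S'` for `δ`.

No new definitions; the helper lemmas are private.  Mathlib only.
-/

noncomputable section

-- `Summit.Langlands.Langlands.…` (summit = sub-problem name, D-0017 layout) trips `dupNamespace` on every decl;
-- project-wide option (lakefile `weak.linter.dupNamespace = false`).
set_option linter.dupNamespace false
set_option autoImplicit false

open scoped Matrix

namespace Summit.Langlands.Langlands.Cruxes.ResiduallyYoshidaLifting.SectorKlingenSplit.Fibre

/-- The scalar matrix `a • 1` acts on vectors as the scalar `a`. [folklore] -/
private theorem scalar_mulVec_eq_smul {k : Type*} [Field k] {n : Type*} [Fintype n] [DecidableEq n] (a : k)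
    (w : n → k) : Matrix.scalar n a *ᵥ w = a • w := by
  ext i
  simp [Matrix.scalar_apply, Matrix.mulVec_diagonal]

/-- An eigenvalue with a non-zero eigenvector is a root of the characteristic polynomial: `det (μ • 1 - M) = 0`
since `μ • 1 - M` has a non-trivial kernel. [folklore] -/
private theorem isRoot_charpoly_of_mulVec_eq_smul {k : Type*} [Field k] {n : Type*} [Fintype n] [DecidableEq n]
    (M : Matrix n n k) {μ : k} {v : n → k} (hv : v ≠ 0) (h : M *ᵥ v = μ • v) : M.charpoly.IsRoot μ := by
  rw [Polynomial.IsRoot.def, Matrix.eval_charpoly, ← Matrix.exists_mulVec_eq_zero_iff]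
  exact ⟨v, hv, by rw [Matrix.sub_mulVec, h, scalar_mulVec_eq_smul, sub_self]⟩

/-- A root of the characteristic polynomial is an eigenvalue with a non-zero eigenvector: `det (μ • 1 - M) = 0`
gives a non-zero kernel vector of `μ • 1 - M`. [folklore] -/
private theorem exists_mulVec_eq_smul_of_isRoot_charpoly {k : Type*} [Field k] {n : Type*} [Fintype n]
    [DecidableEq n] (M : Matrix n n k) {μ : k} (h : M.charpoly.IsRoot μ) : ∃ v : n → k, v ≠ 0 ∧ M *ᵥ v = μ • v := by
  rw [Polynomial.IsRoot.def, Matrix.eval_charpoly, ← Matrix.exists_mulVec_eq_zero_iff] at h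
  obtain ⟨v, hv, hMv⟩ := h
  refine ⟨v, hv, ?_⟩
  rw [Matrix.sub_mulVec, scalar_mulVec_eq_smul, sub_eq_zero] at hMv
  exact hMv.symm

/-- Over an algebraically closed field every `2 × 2` matrix has an eigenvalue with a non-zero eigenvector (its
characteristic polynomial has degree `2 ≠ 0`, hence a root). [folklore] -/
private theorem exists_eigenvector {k : Type*} [Field k] [IsAlgClosed k] (M : Matrix (Fin 2) (Fin 2) k) :
    ∃ (β : k) (y : Fin 2 → k), M.charpoly.IsRoot β ∧ y ≠ 0 ∧ M *ᵥ y = β • y := by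
  obtain ⟨β, hβ⟩ : ∃ β, M.charpoly.IsRoot β :=
    IsAlgClosed.exists_root _ (by rw [Matrix.charpoly_degree_eq_dim, Fintype.card_fin]; exact two_ne_zero)
  obtain ⟨y, hy, hMy⟩ := exists_mulVec_eq_smul_of_isRoot_charpoly M hβ
  exact ⟨β, y, hβ, hy, hMy⟩

/-- Two vectors of `k²` separated by a matrix `X` (`X y = 0`, `X y₂ ≠ 0`, `y ≠ 0`) form a basis: every vector is
`a • y + b • y₂`. [folklore] -/
private theorem exists_eq_add_smul_of_separated {k : Type*} [Field k] (X : Matrix (Fin 2) (Fin 2) k)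
    {y y₂ : Fin 2 → k} (hy : y ≠ 0) (hXy : X *ᵥ y = 0) (hXy₂ : X *ᵥ y₂ ≠ 0) (w : Fin 2 → k) :
    ∃ a b : k, w = a • y + b • y₂ := by
  have hli : LinearIndependent k ![y, y₂] := by
    refine LinearIndependent.pair_iff.2 fun s t hst ↦ ?_
    have ht : t = 0 := by
      have hX := congrArg (X *ᵥ ·) hst
      simp only [Matrix.mulVec_add, Matrix.mulVec_smul, hXy, smul_zero, zero_add, Matrix.mulVec_zero] at hX
      exact (smul_eq_zero.1 hX).resolve_right hXy₂
    rw [ht, zero_smul, add_zero] at hst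
    exact ⟨(smul_eq_zero.1 hst).resolve_right hy, ht⟩
  let bs := basisOfLinearIndependentOfCardEqFinrank hli (by simp)
  have hb : ⇑bs = ![y, y₂] := coe_basisOfLinearIndependentOfCardEqFinrank _ _
  exact ⟨bs.repr w 0, bs.repr w 1, by conv_lhs => rw [← bs.sum_repr w, Fin.sum_univ_two, hb]; simp⟩

/-- **Stub LR2 `stub_crossRatioOfTameEigen`** (the eigenvalue reading of LR): over an algebraically closed field, if
a NON-ZERO `X ∈ M₂(k)` satisfies `S X = q · X S'`, then `α = q β` for some root `α` of `charpoly S` and some root `β`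
of `charpoly S'` (apply `S` to `X y` for an eigenvector `y` of `S'`; if `X y = 0`, complete `y` to a basis `y, y₂`, in
which `S'` is upper triangular with second diagonal entry `δ`, and apply `S` to `X y₂`).  With LR: a Greenberg–Selmer
class ramified at `v ∤ p` forces a CROSS RATIO `α / β = q_v` between the eigenvalues of `σ̄(Frob_v)` and
`σ̄'(Frob_v)`. [folklore] -/
theorem stub_crossRatioOfTameEigen :
    ∀ (k : Type) [Field k] [IsAlgClosed k] (S S' X : Matrix (Fin 2) (Fin 2) k) (q : k),
      X ≠ 0 → S * X = q • (X * S') →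
      ∃ α β : k, S.charpoly.IsRoot α ∧ S'.charpoly.IsRoot β ∧ α = q * β := by
  intro k _ _ S S' X q hX hSX
  -- the intertwining relation on vectors: `S (X w) = q • X (S' w)`
  have hrel : ∀ w : Fin 2 → k, S *ᵥ (X *ᵥ w) = q • (X *ᵥ (S' *ᵥ w)) := fun w ↦ by
    rw [Matrix.mulVec_mulVec, hSX, Matrix.smul_mulVec, ← Matrix.mulVec_mulVec]
  -- an eigenvector `y` of `S'` for a root `β` of `charpoly S'`
  obtain ⟨β, y, hβ, hy, hS'y⟩ := exists_eigenvector S'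
  by_cases hXy : X *ᵥ y = 0
  · -- degenerate case: `X y = 0`; pick `y₂` with `X y₂ ≠ 0` and write `S' y₂ = γ y + δ y₂`
    obtain ⟨y₂, hXy₂⟩ : ∃ y₂, X *ᵥ y₂ ≠ 0 := by
      by_contra hall
      push Not at hall
      exact hX (Matrix.ext_iff_mulVec.mpr fun v ↦ by rw [hall v, Matrix.zero_mulVec])
    obtain ⟨γ, δ, hS'y₂⟩ := exists_eq_add_smul_of_separated X hy hXy hXy₂ (S' *ᵥ y₂)
    -- `S (X y₂) = (q δ) (X y₂)`
    have hSXy₂ : S *ᵥ (X *ᵥ y₂) = (q * δ) • (X *ᵥ y₂) := by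
      rw [hrel, hS'y₂, Matrix.mulVec_add, Matrix.mulVec_smul, Matrix.mulVec_smul, hXy, smul_zero, zero_add,
        smul_smul]
    refine ⟨q * δ, δ, isRoot_charpoly_of_mulVec_eq_smul S hXy₂ hSXy₂, ?_, rfl⟩
    -- `δ` is a root of `charpoly S'`
    by_cases hβδ : β = δ
    · exact hβδ ▸ hβ
    · have hne : δ - β ≠ 0 := sub_ne_zero.2 (Ne.symm hβδ)
      refine isRoot_charpoly_of_mulVec_eq_smul S' (v := y₂ + (γ / (δ - β)) • y) ?_ ?_
      · -- non-zero: `X` does not kill it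
        intro h0
        apply hXy₂
        have hX0 := congrArg (X *ᵥ ·) h0
        simp only [Matrix.mulVec_add, Matrix.mulVec_smul, hXy, smul_zero, add_zero, Matrix.mulVec_zero] at hX0
        exact hX0
      · -- eigenvector for `δ`
        rw [Matrix.mulVec_add, Matrix.mulVec_smul, hS'y₂, hS'y, smul_add, smul_smul, smul_smul]
        have hcoef : γ + γ / (δ - β) * β = δ * (γ / (δ - β)) := by
          field_simp
          ring
        calc γ • y + δ • y₂ + (γ / (δ - β) * β) • y = (γ + γ / (δ - β) * β) • y + δ • y₂ := by
              rw [add_smul]; abel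
          _ = δ • y₂ + (δ * (γ / (δ - β))) • y := by rw [hcoef]; abel
  · -- generic case: `X y ≠ 0` is an eigenvector of `S` for `q β`
    refine ⟨q * β, β, isRoot_charpoly_of_mulVec_eq_smul S hXy ?_, hβ, rfl⟩
    rw [hrel, hS'y, Matrix.mulVec_smul, smul_smul]

end Summit.Langlands.Langlands.Cruxes.ResiduallyYoshidaLifting.SectorKlingenSplit.Fibre
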